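import Literature.NumberTheory.Automorphic.ConjugateSelfDualInfinityType
import Literature.NumberTheory.Automorphic.IdeleClassCharacterHecke
import HarnessLib

/-!
# [Liu2021, Def. 4.1 / Def. 4.3 / Rem. 4.4] twisting a conjugate-symplectic character by a conjugate-orthogonal
# character of infinity type `0`: same sign datum, same weight, same CM type

Topic `NumberTheory/Automorphic`; namespace `Literature.NumberTheory.Automorphic.IdeleClassGroup` (the home of the tree's
`IsConjugateSelfDual` ∕ `IsConjugateOrthogonal` ∕ `IsConjugateSymplectic` ∕ `HasInfinityType` ∕ `HasWeight` ∕ `HasCMType` ∕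
`IsConjugateSymplectic.cmType`).  THEOREMS ONLY (no definition, no named fact, no instance, no `sorry`); ORIENTATION-NEUTRAL
(no label is called print's; every statement holds for an arbitrary twist `η`).

[Liu2021] Def. 4.1 (l. 1880–1890): a unitary automorphic character `μ` of `𝔸_E^×` is *conjugate orthogonal* if `μ|_{𝔸_F^×} = 1`,
*conjugate symplectic* if `μ|_{𝔸_F^×} = μ_{E/F}`; Def. 4.3: weight `𝔴_μ` and CM type `Φ_μ` of a conjugate-symplectic `μ`; Rem. 4.4 and
App. D Lem. D.1 (4) ∕ Thm. D.6 (1) (l. 5235, 5436–5443) use the companion label `μᶜ·χ̌` — a conjugate-symplectic character TWISTED by the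
conjugate-orthogonal, archimedeanly trivial `χ̌` (App. D §D.1 l. 5224: `χ̌(x) = χ(x/xᶜ)`, so `χ̌|_{𝔸_F^×} = 1`, `χ̌_∞ = 1`).  This file is
the character algebra behind that sentence, for the tree's unitary idèle-class characters `ψ η : C_L →ₜ* S¹`:

* `infinityTypeChar_add`, `HasInfinityType.mul`, `HasInfinityType.mul_zero_right` — ∞-types add under products;
* `IsConjugateOrthogonal.mul`, **`IsConjugateSymplectic.mul_isConjugateOrthogonal`** (+ `…orthogonal_mul_symplectic`) — Def. 4.1 under
  products: symplectic × orthogonal = symplectic;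
* `HasWeight.mul_of_hasInfinityType_zero`, `HasCMType.mul_of_hasInfinityType_zero` — a twist by an `η` of ∞-type `0` keeps the weight
  and the CM type (Def. 4.3);
* **`IsConjugateSymplectic.infinityType_mul` ∕ `weightOf_mul` ∕ `cmType_mul`** — for the FUNCTIONS of `ψ` of ★ `ConjugateSelfDualInfinityType`:
  `Φ_{ψ·η} = Φ_ψ`, `𝔴_{ψ·η} = 𝔴_ψ`;
* `toHeckeCharacter_mul` — the bridge `toHeckeCharacter (ψ·η) = toHeckeCharacter ψ · toHeckeCharacter η` to the tree's Hecke characters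
  (a unitary Hecke character is `toHeckeCharacter η` for some `η`, ★ `HarrisKudlaSweet1996.exists_toHeckeCharacter_eq_of_isUnitary`;
  ★ `CheckOfChi.hasInfinityType_zero_checkOfChi`, ★ `CheckOfChiGalConj.galConj_checkOfChi` then supply the instances `η := χ̌`, `χ̌ᶜ`).

Consumer: cell hodgecm-mathlib, d6 line, census `CENSUS-S1b-CaseB-relabel` row 1 (the companion label of [Liu Lem. D.1 (4)] is again a
weight-one conjugate-symplectic character with the SAME `cmType` once the twist is archimedeanly trivial; with ★ `cmType_galConj`
(`Φ_{ψᶜ} = Φ̄_ψ`) both columns' companions `ψᶜ·χ̌`, `ψ·χ̌ᶜ` are covered).  HC_CM is proved only modulo the 7 printed citations until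
rung 0 closes; this file proves no cell binder.

## References
* [Liu2021] Y. Liu, *Fourier–Jacobi cycles and arithmetic relative trace formula*, Camb. J. Math. 9 (2021) = arXiv:2102.11518: Def. 4.1,
  Rem. 4.2, Def. 4.3 (l. 1880–1926), Rem. 4.4 (l. 1930–1933), App. D §D.1 (l. 5224), Lem. D.1 (4) (l. 5235), Thm. D.6 (1) (l. 5436–5443).
* [WeilBNT1967] A. Weil, *Basic Number Theory* (1967), Ch. VII §3 (characters of `K_∞ˣ`).
-/

set_option autoImplicit false

noncomputable section

open NumberField

namespace Literature.NumberTheory.Automorphic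

/-! ## §1 ∞-types add under products (any number field) -/

section InfinityType

variable (K : Type) [Field K] [NumberField K]

/-- The ∞-type characters multiply: `u ↦ ∏_v (u_v/‖u_v‖)^{e_v + e'_v}` is the product of the characters of types `e`, `e'`.
[cite: WeilBNT1967, Ch. VII §3] -/
theorem infinityTypeChar_add (e e' : InfinitePlace K → ℤ) :
    infinityTypeChar K (e + e') = infinityTypeChar K e * infinityTypeChar K e' := by
  ext u
  rw [MonoidHom.mul_apply, infinityTypeChar_apply, infinityTypeChar_apply, infinityTypeChar_apply, Circle.coe_mul,
    ← Circle.coe_mul, ← Finset.prod_mul_distrib]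
  congr 2
  funext v
  rw [Pi.add_apply, zpow_add]

namespace IdeleClassGroup

variable {K}

/-- **∞-types add**: if `ψ`, `η : C_K →ₜ* S¹` have ∞-types `e`, `e'`, then `ψ·η` has ∞-type `e + e'`. [cite: WeilBNT1967, Ch. VII §3] -/
theorem HasInfinityType.mul {ψ η : IdeleClassGroup K →ₜ* Circle} {e e' : InfinitePlace K → ℤ}
    (hψ : HasInfinityType K ψ e) (hη : HasInfinityType K η e') : HasInfinityType K (ψ * η) (e + e') := fun u => by
  change ψ _ * η _ = _
  rw [infinityTypeChar_add, MonoidHom.mul_apply, hψ u, hη u]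

/-- … in particular a twist by a character of ∞-type `0` keeps the ∞-type. [cite: WeilBNT1967, Ch. VII §3] -/
theorem HasInfinityType.mul_zero_right {ψ η : IdeleClassGroup K →ₜ* Circle} {e : InfinitePlace K → ℤ}
    (hψ : HasInfinityType K ψ e) (hη : HasInfinityType K η 0) : HasInfinityType K (ψ * η) e := by
  simpa only [add_zero] using hψ.mul hη

/-- **Bridge to Hecke characters**: `toHeckeCharacter (ψ·η) = toHeckeCharacter ψ · toHeckeCharacter η`. [folklore]
[cite: WeilBNT1967, Ch. VII §3] -/
theorem toHeckeCharacter_mul (ψ η : IdeleClassGroup K →ₜ* Circle) :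
    toHeckeCharacter K (ψ * η) = toHeckeCharacter K ψ * toHeckeCharacter K η := by
  refine GaloisRepresentations.HeckeCharacter.ext fun x => Units.ext ?_
  rw [coe_toHeckeCharacter_apply]
  rfl

end IdeleClassGroup

end InfinityType

/-! ## §2 Def. 4.1 under products; Def. 4.3 under archimedeanly trivial twists (CM field) -/

namespace IdeleClassGroup

variable {L : Type} [Field L] [NumberField L] [IsCMField L]

omit [IsCMField L] in
/-- Conjugate orthogonal × conjugate orthogonal = conjugate orthogonal. [cite: Liu2021, Def. 4.1] -/
theorem IsConjugateOrthogonal.mul {ψ η : IdeleClassGroup L →ₜ* Circle} (hψ : IsConjugateOrthogonal L ψ)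
    (hη : IsConjugateOrthogonal L η) : IsConjugateOrthogonal L (ψ * η) := fun a => by
  change ψ _ * η _ = 1
  rw [hψ a, hη a, mul_one]

/-- **Conjugate symplectic × conjugate orthogonal = conjugate symplectic** (`(ψ·η)|_{C_{L⁺}} = ε_{L/L⁺} · 1`): the companion label
`μᶜ·χ̌` of [Liu2021, Lem. D.1 (4)] is conjugate symplectic. [cite: Liu2021, Def. 4.1; Rem. 4.4; Lem. D.1 (4) (l. 5235)] -/
theorem IsConjugateSymplectic.mul_isConjugateOrthogonal {ψ η : IdeleClassGroup L →ₜ* Circle} (hψ : IsConjugateSymplectic L ψ)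
    (hη : IsConjugateOrthogonal L η) : IsConjugateSymplectic L (ψ * η) := fun a => by
  change ψ _ * η _ = _
  rw [hψ a, hη a, mul_one]

/-- Conjugate orthogonal × conjugate symplectic = conjugate symplectic. [cite: Liu2021, Def. 4.1; Rem. 4.4] -/
theorem IsConjugateOrthogonal.mul_isConjugateSymplectic {ψ η : IdeleClassGroup L →ₜ* Circle} (hη : IsConjugateOrthogonal L η)
    (hψ : IsConjugateSymplectic L ψ) : IsConjugateSymplectic L (η * ψ) := by
  rw [mul_comm]; exact hψ.mul_isConjugateOrthogonal hη

omit [IsCMField L] in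
/-- A twist by a character of ∞-type `0` keeps the weight (Def. 4.3). [cite: Liu2021, Def. 4.3] -/
theorem HasWeight.mul_of_hasInfinityType_zero {ψ η : IdeleClassGroup L →ₜ* Circle} {𝔴 : InfinitePlace L → ℕ}
    (hψ : HasWeight L ψ 𝔴) (hη : HasInfinityType L η 0) : HasWeight L (ψ * η) 𝔴 := by
  obtain ⟨e, he, rfl⟩ := hψ
  exact ⟨e, he.mul_zero_right hη, rfl⟩

/-- A twist by a character of ∞-type `0` keeps the CM type (Def. 4.3). [cite: Liu2021, Def. 4.3] -/
theorem HasCMType.mul_of_hasInfinityType_zero {ψ η : IdeleClassGroup L →ₜ* Circle}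
    {Φ : Literature.AlgebraicGeometry.Motives.CMType L} (hψ : HasCMType L ψ Φ) (hη : HasInfinityType L η 0) :
    HasCMType L (ψ * η) Φ := by
  obtain ⟨e, hne, he, rfl⟩ := hψ
  exact ⟨e, hne, he.mul_zero_right hη, rfl⟩

/-- **`e_{ψ·η} = e_ψ`** for the ∞-type function of a conjugate-symplectic character twisted by an archimedeanly trivial conjugate-orthogonal
one. [cite: Liu2021, Rem. 4.2; Def. 4.3] -/
theorem IsConjugateSymplectic.infinityType_mul {ψ η : IdeleClassGroup L →ₜ* Circle} (hψ : IsConjugateSymplectic L ψ)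
    (hη : IsConjugateOrthogonal L η) (hη0 : HasInfinityType L η 0) :
    (hψ.mul_isConjugateOrthogonal hη).infinityType = hψ.infinityType :=
  (hψ.mul_isConjugateOrthogonal hη).infinityType_eq (hψ.hasInfinityType_infinityType.mul_zero_right hη0)

/-- **`𝔴_{ψ·η} = 𝔴_ψ`** (so a weight-one `ψ` stays weight one). [cite: Liu2021, Def. 4.3; Thm. D.6 (1) (l. 5436)] -/
theorem IsConjugateSymplectic.weightOf_mul {ψ η : IdeleClassGroup L →ₜ* Circle} (hψ : IsConjugateSymplectic L ψ)
    (hη : IsConjugateOrthogonal L η) (hη0 : HasInfinityType L η 0) :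
    (hψ.mul_isConjugateOrthogonal hη).weightOf = hψ.weightOf :=
  (hψ.mul_isConjugateOrthogonal hη).weightOf_eq (hψ.hasWeight_weightOf.mul_of_hasInfinityType_zero hη0)

/-- **`Φ_{ψ·η} = Φ_ψ`**: the CM type of [Liu2021, Def. 4.3] is unchanged by an archimedeanly trivial conjugate-orthogonal twist — so the
companion label of Lem. D.1 (4) has CM type `Φ_{ψᶜ} = Φ̄_ψ` (★ `cmType_galConj`). [cite: Liu2021, Def. 4.3; Rem. 4.4; Lem. D.1 (4) (l. 5235)] -/
theorem IsConjugateSymplectic.cmType_mul {ψ η : IdeleClassGroup L →ₜ* Circle} (hψ : IsConjugateSymplectic L ψ)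
    (hη : IsConjugateOrthogonal L η) (hη0 : HasInfinityType L η 0) :
    (hψ.mul_isConjugateOrthogonal hη).cmType = hψ.cmType :=
  (hψ.mul_isConjugateOrthogonal hη).cmType_eq (hψ.hasCMType_cmType.mul_of_hasInfinityType_zero hη0)

/-- Packaged form for consumers quantifying over `(μ, hμ, hw)`: the twist `ψ·η` is conjugate symplectic, of weight `𝔴` whenever `ψ` is,
and of the same CM type. [cite: Liu2021, Def. 4.1; Def. 4.3; Lem. D.1 (4) (l. 5235)] -/
theorem IsConjugateSymplectic.mul_isConjugateOrthogonal_spec {ψ η : IdeleClassGroup L →ₜ* Circle} (hψ : IsConjugateSymplectic L ψ)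
    (hη : IsConjugateOrthogonal L η) (hη0 : HasInfinityType L η 0) {𝔴 : InfinitePlace L → ℕ} (hw : HasWeight L ψ 𝔴) :
    ∃ h : IsConjugateSymplectic L (ψ * η), HasWeight L (ψ * η) 𝔴 ∧ h.cmType = hψ.cmType :=
  ⟨hψ.mul_isConjugateOrthogonal hη, hw.mul_of_hasInfinityType_zero hη0, hψ.cmType_mul hη hη0⟩

end IdeleClassGroup

end Literature.NumberTheory.Automorphic

end
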